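import Summits.FinalStateConjecture.FinalStateConjecture.Theorems.EIHFluxBalanceInertialRecessionChargeKinematicsSingleton

/-!
# Route EIHFluxBalance — `InertialRecession`, line `old-light-leaves-the-cone`: charge kinematics,
# XXI (general-N groundwork: the cluster window law)

Helper file for the crux `stmt-FinalStateConjecture-10166`
(`Summit.FinalStateConjecture.FinalStateConjecture.Theses.EIHFluxBalance.InertialRecession`), second line
lead, endgame stub `stub_expandingChargeKinematics` (S4: abstract quasi-conserved window charges with the
slack-form window law and the single-hole identification ⇒ Cesàro velocities of the painted centres).
THE ESCAPE SERIES: the endgame for `N = 3` (Case A all-pairs freezing is `ChargeKinematicsAllPairs*`;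
Case B, the escape of a fast hole from a velocity-tight pair, is this series; the assembly is
`ChargeKinematicsThree`).

XXI — GENERAL-N GROUNDWORK: THE CLUSTER WINDOW LAW along a clearance function (`cluster_window_law`), the
cluster version of `pair_window_law` used by mechanisms (E) and (P) of the general-N plan.

Every statement is Mathlib-only real analysis over the stub's verbatim hypotheses ([folklore]); the abstract
charge `P` is arbitrary (adversarial), constrained only by the window law and the identification.
-/

set_option linter.dupNamespace false

noncomputable section

open Filter Set Metric Real
open scoped Topology

namespace Summit.FinalStateConjecture.FinalStateConjecture.Theorems.ChargeKinematics

open Literature.Geometry.Lorentzian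

/-! ## The cluster window law -/

section ClusterWindow

open MeasureTheory intervalIntegral

variable {N : ℕ} {M : Fin N → ℝ} {ξ v : Fin N → ℝ → E3} {κ : ℝ} {P : ℝ → E3 → ℝ → Fin 4 → ℝ}

set_option maxHeartbeats 400000 in
/-- **THE CLUSTER WINDOW LAW along a clearance function** (the pair case is `pair_window_law`). Fix a
finite cluster `U` with an anchor `a` (normally a member) and a member `b ∈ U`, `b ≠ a`,, and a rate `0 < c₂ ≤ min((κ−κ²)/2, 1)`.
With ONE constant, ONE threshold and ONE error `e_w → 0`: for every late interval `[s₁, s₂]` and every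
`4`-Lipschitz `ψ` with, along the interval, `4‖ξ_a − ξ_j‖ ≤ ψ` and `2‖ξ_a − ξ_j‖ ≤ c₂ s` for all members
`j ∈ U` and every non-member at distance `≥ ψ` from `ξ_a`, the window `(ξ_a(s), min(ψ(s)/2, c₂s))` is
`1/2`-admissible (members inside `R/2`, non-members beyond `2R`), its charge changes by at most
`C_w∫(R⁻² + R^{-7/4}) + e_w(s₁)`, and at every time of the interval it is the kinematic cluster charge
`(Σ_j M_jγ_j, Σ_j M_jγ_j v_j)` up to `e_w(s)`. Mechanisms (E), (P) of the general-`N` plan use it with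
`ψ = |⟪u, ξ_ext − ξ_a⟫|` and `ψ = θs`. [folklore] -/
theorem cluster_window_law (hκ0 : 0 < κ) (hκ1 : κ < 1)
    (hξ : ∀ i, ContDiff ℝ ((⊤ : ℕ∞) : WithTop ℕ∞) (ξ i))
    (hcone : ∀ i, ∀ᶠ t in atTop, ‖ξ i t‖ ≤ κ ^ 2 * t)
    (hsep : ∀ i j, i ≠ j → Tendsto (fun t ↦ ‖ξ i t - ξ j t‖) atTop atTop)
    (hk : ∃ k : ℝ, 0 ≤ k ∧ k < 1 ∧ ∀ i, ∀ᶠ t in atTop, ‖v i t‖ ≤ k)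
    (hslave : ∀ i, Tendsto (fun t ↦ deriv (ξ i) t - v i t) atTop (𝓝 0))
    (hW : ∀ δ : ℝ, 0 < δ → δ < 1 → ∃ (C R₀ T : ℝ) (η : ℝ → ℝ), Tendsto η atTop (𝓝 0) ∧ ∀ (t₁ t₂ : ℝ) (c : ℝ → E3) (R : ℝ → ℝ), T ≤ t₁ → t₁ ≤ t₂ → (∀ s ∈ Set.Icc t₁ t₂, ∀ s' ∈ Set.Icc t₁ t₂, ‖c s - c s'‖ ≤ 2 * |s - s'| ∧ |R s - R s'| ≤ 2 * |s - s'|) → (∀ s ∈ Set.Icc t₁ t₂, (R₀ ≤ R s ∧ ‖c s‖ + R s ≤ (κ + κ ^ 2) / 2 * s ∧ ∀ j, ‖ξ j s - c s‖ ≤ (1 - δ) * R s ∨ (1 + δ) * R s ≤ ‖ξ j s - c s‖)) → ∀ μ : Fin 4, |P t₂ (c t₂) (R t₂) μ - P t₁ (c t₁) (R t₁) μ| ≤ C * (∫ s in t₁..t₂, ((R s) ^ 2)⁻¹ + ((R s) ^ (7 / 4 : ℝ))⁻¹) + η t₁)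
    (hI : ∃ (C R₀ T : ℝ) (ζ : ℝ → ℝ), Tendsto ζ atTop (𝓝 0) ∧ (∀ (t : ℝ) (i : Fin N) (R : ℝ), T ≤ t → R₀ ≤ R → ‖ξ i t‖ + R ≤ (κ + κ ^ 2) / 2 * t → (∀ j, j ≠ i → 3 * R ≤ ‖ξ i t - ξ j t‖) → |P t (ξ i t) R 0 - M i * (√(1 - ‖v i t‖ ^ 2))⁻¹| ≤ ζ t + C / R ∧ ∀ k : Fin 3, |P t (ξ i t) R k.succ - M i * (√(1 - ‖v i t‖ ^ 2))⁻¹ * v i t k| ≤ ζ t + C / R) ∧ (∀ (t : ℝ) (c : E3) (R : ℝ) (A : Finset (Fin N)) (ρ : Fin N → ℝ), T ≤ t → R₀ ≤ R → ‖c‖ + R ≤ (κ + κ ^ 2) / 2 * t → (∀ j ∈ A, ‖ξ j t - c‖ ≤ R / 2) → (∀ j ∉ A, 2 * R ≤ ‖ξ j t - c‖) → (∀ j ∈ A, R₀ ≤ ρ j ∧ ρ j ≤ R / 4 ∧ ∀ j', j' ≠ j → 3 * ρ j ≤ ‖ξ j t - ξ j' t‖) → ∀ μ : Fin 4, |P t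 c R μ - ∑ j ∈ A, P t (ξ j t) (ρ j) μ| ≤ C * (R⁻¹ + ∑ j ∈ A, (ρ j)⁻¹) + ζ t))
    (U : Finset (Fin N)) {a b : Fin N} (hb : b ∈ U) (hab : a ≠ b) {c₂ : ℝ} (hc₂ : 0 < c₂)
    (hc₂κ : c₂ ≤ (κ - κ ^ 2) / 2) (hc₂1 : c₂ ≤ 1) :
    ∃ (Cw Tw : ℝ) (ew : ℝ → ℝ), 0 ≤ Cw ∧ Tendsto ew atTop (𝓝 0) ∧ (∀ t, Tw ≤ t → 0 ≤ ew t) ∧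
      ∀ (s₁ s₂ : ℝ) (ψ : ℝ → ℝ), Tw ≤ s₁ → s₁ ≤ s₂ →
        (∀ s ∈ Set.Icc s₁ s₂, ∀ s' ∈ Set.Icc s₁ s₂, |ψ s - ψ s'| ≤ 4 * |s - s'|) →
        (∀ s ∈ Set.Icc s₁ s₂, (∀ j ∈ U, 4 * ‖ξ a s - ξ j s‖ ≤ ψ s ∧ 2 * ‖ξ a s - ξ j s‖ ≤ c₂ * s) ∧
          ∀ l ∉ U, ψ s ≤ ‖ξ l s - ξ a s‖) →
        (∀ μ : Fin 4, |P s₂ (ξ a s₂) (min (ψ s₂ / 2) (c₂ * s₂)) μ -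
            P s₁ (ξ a s₁) (min (ψ s₁ / 2) (c₂ * s₁)) μ| ≤
          Cw * (∫ s in s₁..s₂, ((min (ψ s / 2) (c₂ * s)) ^ 2)⁻¹ +
            ((min (ψ s / 2) (c₂ * s)) ^ (7 / 4 : ℝ))⁻¹) + ew s₁) ∧
        (∀ s ∈ Set.Icc s₁ s₂,
          |P s (ξ a s) (min (ψ s / 2) (c₂ * s)) 0 - ∑ j ∈ U, M j * (√(1 - ‖v j s‖ ^ 2))⁻¹| ≤ ew s ∧
          ∀ k' : Fin 3, |P s (ξ a s) (min (ψ s / 2) (c₂ * s)) k'.succ -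
              ∑ j ∈ U, M j * (√(1 - ‖v j s‖ ^ 2))⁻¹ * v j s k'| ≤ ew s) := by
  classical
  obtain ⟨C, R₀, T, η, hη, hlaw⟩ := hW (1 / 2) (by norm_num) (by norm_num)
  obtain ⟨C', R₀', T', ζ, hζ, -, hadd⟩ := id hI
  obtain ⟨k, hk0, hk1, hvk⟩ := id hk
  have hκκ : 0 < κ - κ ^ 2 := by nlinarith
  have hd : ∀ i, Differentiable ℝ (ξ i) := fun i ↦ (contDiff_infty_iff_deriv.mp (hξ i)).1
  -- (1) Lipschitz thresholds, least pairwise distance `D`, member radius `ρ = min(D/3, c₂ s/4)`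
  choose TLi hTLi using fun i ↦ exists_forall_norm_sub_le_two_mul (hd i) (hslave i) hk1.le (hvk i)
  haveI : Nonempty (Fin N) := ⟨a⟩
  obtain ⟨TL, hTLge, hTL0⟩ : ∃ TL : ℝ, (∀ i, TLi i ≤ TL) ∧ 0 ≤ TL :=
    ⟨Finset.univ.sup' Finset.univ_nonempty TLi ⊔ 0,
      fun i ↦ (Finset.le_sup' TLi (Finset.mem_univ i)).trans le_sup_left, le_sup_right⟩
  obtain ⟨D, hDle, hDinf, hDlip⟩ : ∃ D : ℝ → ℝ, (∀ s (i j : Fin N), i ≠ j → D s ≤ ‖ξ i s - ξ j s‖) ∧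
      Tendsto D atTop atTop ∧ (∀ s s', TL ≤ s → TL ≤ s' → |D s - D s'| ≤ 4 * |s - s'|) := by
    let S : Finset (Fin N × Fin N) := Finset.univ.filter fun p ↦ p.1 ≠ p.2
    have hmem : ∀ {i j : Fin N}, i ≠ j → (i, j) ∈ S := fun hij ↦
      Finset.mem_filter.mpr ⟨Finset.mem_univ _, hij⟩
    have hSne : S.Nonempty := ⟨(a, b), hmem hab⟩
    refine ⟨fun s ↦ S.inf' hSne fun p ↦ ‖ξ p.1 s - ξ p.2 s‖, fun s i j hij ↦ ?_, ?_, fun s s' hs hs' ↦ ?_⟩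
    · exact Finset.inf'_le (fun p : Fin N × Fin N ↦ ‖ξ p.1 s - ξ p.2 s‖) (hmem hij)
    · refine tendsto_inf'_atTop hSne fun p hp ↦ hsep p.1 p.2 ?_
      exact (Finset.mem_filter.mp hp).2
    · refine abs_inf'_sub_inf'_le hSne fun p _ ↦ ?_
      have h1 := hTLi p.1 s s' ((hTLge _).trans hs) ((hTLge _).trans hs')
      have h2 := hTLi p.2 s s' ((hTLge _).trans hs) ((hTLge _).trans hs')
      have h3 : |‖ξ p.1 s - ξ p.2 s‖ - ‖ξ p.1 s' - ξ p.2 s'‖| ≤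
          ‖(ξ p.1 s - ξ p.2 s) - (ξ p.1 s' - ξ p.2 s')‖ := abs_norm_sub_norm_le _ _
      have h4 : ‖(ξ p.1 s - ξ p.2 s) - (ξ p.1 s' - ξ p.2 s')‖ ≤
          ‖ξ p.1 s - ξ p.1 s'‖ + ‖ξ p.2 s - ξ p.2 s'‖ := by
        have : (ξ p.1 s - ξ p.2 s) - (ξ p.1 s' - ξ p.2 s') =
            (ξ p.1 s - ξ p.1 s') - (ξ p.2 s - ξ p.2 s') := by abel
        rw [this]; exact norm_sub_le _ _
      linarith
  set ρ : ℝ → ℝ := fun s ↦ min (D s / 3) (c₂ / 4 * s) with hρdef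
  have hρlip : ∀ s s', TL ≤ s → TL ≤ s' → |ρ s - ρ s'| ≤ 2 * |s - s'| := by
    intro s s' hs hs'
    refine (abs_min_sub_min_le_max _ _ _ _).trans (max_le ?_ ?_)
    · rw [← sub_div, abs_div, abs_of_pos (by norm_num : (0 : ℝ) < 3), div_le_iff₀ (by norm_num : (0 : ℝ) < 3)]
      have := hDlip s s' hs hs'
      linarith [abs_nonneg (s - s')]
    · rw [← mul_sub, abs_mul, abs_of_pos (by positivity : 0 < c₂ / 4)]
      exact mul_le_mul_of_nonneg_right (by linarith) (abs_nonneg _)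
  have hρcone : ∀ s, TL ≤ s → ρ s ≤ (κ - κ ^ 2) / 2 * s := fun s hs ↦ by
    have hs0 : 0 ≤ s := hTL0.trans hs
    exact (min_le_right _ _).trans (by nlinarith)
  have hρsep : ∀ i, ∀ s, TL ≤ s → ∀ j, j ≠ i → 3 * ρ s ≤ ‖ξ i s - ξ j s‖ := fun i s hs j hj ↦ by
    have := hDle s i j hj.symm
    have := min_le_left (D s / 3) (c₂ / 4 * s)
    linarith
  have hρinf : Tendsto ρ atTop atTop := by
    rw [Filter.tendsto_atTop]
    intro b'
    filter_upwards [(hDinf.atTop_div_const (by norm_num : (0 : ℝ) < 3)).eventually_ge_atTop b',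
      (tendsto_id.const_mul_atTop (by positivity : 0 < c₂ / 4)).eventually_ge_atTop b'] with s h1 h2
    exact le_min h1 h2
  -- single-hole identifications at `ρ` for every hole
  choose Cj Tj ej hCj hej hej0 hlawj hidj hρ1j using fun i ↦
    singleton_law hκ0 hκ1 hξ hcone hk hslave hW hI i (R := ρ) hρlip hρcone (hρsep i) hρinf
  clear hW hI
  -- (2) the error function and the threshold
  set Rlow : ℝ → ℝ := fun s ↦ min (2 * D s) (c₂ * s) with hRlowdef
  have hRlowinf : Tendsto Rlow atTop atTop := by
    rw [Filter.tendsto_atTop]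
    intro b'
    filter_upwards [(hDinf.const_mul_atTop (by norm_num : (0 : ℝ) < 2)).eventually_ge_atTop b',
      (tendsto_id.const_mul_atTop hc₂).eventually_ge_atTop b'] with s h1 h2
    exact le_min h1 h2
  set nU : ℝ := (U.card : ℝ) with hnUdef
  set ew : ℝ → ℝ := fun s ↦ |η s| + (|ζ s| + |C'| * ((Rlow s)⁻¹ + nU * (ρ s)⁻¹)) + ∑ j ∈ U, ej j s
    with hewdef
  have hR₀ev : ∀ᶠ s in atTop, max (max R₀ R₀') 1 ≤ Rlow s := hRlowinf.eventually_ge_atTop _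
  have hρev : ∀ᶠ s in atTop, max R₀' 1 ≤ ρ s := hρinf.eventually_ge_atTop _
  have hTjev : ∀ᶠ s in atTop, ∀ j, Tj j ≤ s := eventually_all.mpr fun j ↦ eventually_ge_atTop (Tj j)
  obtain ⟨Tw, hTw⟩ := eventually_atTop.mp ((hcone a).and (hR₀ev.and (hρev.and ((eventually_ge_atTop T).and
    ((eventually_ge_atTop T').and ((eventually_ge_atTop TL).and (hTjev.and
      (eventually_ge_atTop (0 : ℝ)))))))))
  refine ⟨|C|, Tw, ew, abs_nonneg C, ?_, ?_, ?_⟩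
  · -- `ew → 0`
    have h1 : Tendsto (fun t ↦ |η t|) atTop (𝓝 0) := by simpa using hη.abs
    have h2 : Tendsto (fun t ↦ |ζ t|) atTop (𝓝 0) := by simpa using hζ.abs
    have h3 : Tendsto (fun t ↦ |C'| * ((Rlow t)⁻¹ + nU * (ρ t)⁻¹)) atTop (𝓝 0) := by
      have hR := tendsto_inv_atTop_zero.comp hRlowinf
      have hρ := (tendsto_inv_atTop_zero.comp hρinf).const_mul nU
      rw [mul_zero] at hρ
      have := (hR.add hρ).const_mul |C'|
      rw [add_zero, mul_zero] at this
      exact this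
    have h4 : Tendsto (fun t ↦ ∑ j ∈ U, ej j t) atTop (𝓝 0) := by
      have := tendsto_finsetSum U fun j _ ↦ hej j
      rwa [Finset.sum_const_zero] at this
    have := (h1.add (h2.add h3)).add h4
    simp only [add_zero] at this
    exact this
  · -- `0 ≤ ew` after `Tw`
    intro t ht
    obtain ⟨-, hRt, hρt, -, -, -, hTjt, -⟩ := hTw t ht
    have hR1 : 1 ≤ Rlow t := (le_max_right _ _).trans hRt
    have hρ1 : 1 ≤ ρ t := (le_max_right _ _).trans hρt
    have h0 : 0 ≤ ∑ j ∈ U, ej j t := Finset.sum_nonneg fun j _ ↦ hej0 j t (hTjt j)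
    positivity
  intro s₁ s₂ ψ hs₁ h12 hψlip hgeom
  -- facts along the interval
  have hfacts : ∀ s ∈ Set.Icc s₁ s₂, ‖ξ a s‖ ≤ κ ^ 2 * s ∧ max (max R₀ R₀') 1 ≤ Rlow s ∧
      max R₀' 1 ≤ ρ s ∧ T ≤ s ∧ T' ≤ s ∧ TL ≤ s ∧ (∀ j, Tj j ≤ s) ∧ 0 ≤ s :=
    fun s hs ↦ hTw s (hs₁.trans hs.1)
  -- the radius `R = min(ψ/2, c₂ s)` dominates `Rlow` on the interval
  have hRge : ∀ s ∈ Set.Icc s₁ s₂, Rlow s ≤ min (ψ s / 2) (c₂ * s) := by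
    intro s hs
    obtain ⟨hmem, -⟩ := hgeom s hs
    have h4 := (hmem b hb).1
    have hDs : D s ≤ ‖ξ a s - ξ b s‖ := hDle s a b hab
    exact min_le_min (by linarith) le_rfl
  have hR1 : ∀ s ∈ Set.Icc s₁ s₂, 1 ≤ min (ψ s / 2) (c₂ * s) := fun s hs ↦
    ((le_max_right _ _).trans (hfacts s hs).2.1).trans (hRge s hs)
  refine ⟨fun μ ↦ ?_, fun s hs ↦ ?_⟩
  · -- the law along the path `(ξ a, R)`
    obtain ⟨-, -, -, hT1, -, hTL1, -⟩ := hfacts s₁ ⟨le_rfl, h12⟩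
    have key := hlaw s₁ s₂ (fun s ↦ ξ a s) (fun s ↦ min (ψ s / 2) (c₂ * s)) hT1 h12 ?_ ?_ μ
    · refine key.trans ?_
      have hnn : 0 ≤ ∫ s in s₁..s₂, (((min (ψ s / 2) (c₂ * s)) ^ 2)⁻¹ +
          ((min (ψ s / 2) (c₂ * s)) ^ (7 / 4 : ℝ))⁻¹) := by
        apply intervalIntegral.integral_nonneg h12
        intro s hs
        have : 0 < min (ψ s / 2) (c₂ * s) := one_pos.trans_le (hR1 s hs)
        positivity
      have hC : C * (∫ s in s₁..s₂, (((min (ψ s / 2) (c₂ * s)) ^ 2)⁻¹ +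
          ((min (ψ s / 2) (c₂ * s)) ^ (7 / 4 : ℝ))⁻¹)) ≤
          |C| * ∫ s in s₁..s₂, (((min (ψ s / 2) (c₂ * s)) ^ 2)⁻¹ +
            ((min (ψ s / 2) (c₂ * s)) ^ (7 / 4 : ℝ))⁻¹) :=
        mul_le_mul_of_nonneg_right (le_abs_self C) hnn
      have hηt : η s₁ ≤ ew s₁ := by
        obtain ⟨-, hRt, hρt, -, -, -, hTjt, -⟩ := hfacts s₁ ⟨le_rfl, h12⟩
        have hR1' : 1 ≤ Rlow s₁ := (le_max_right _ _).trans hRt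
        have hρ1 : 1 ≤ ρ s₁ := (le_max_right _ _).trans hρt
        have h0 : 0 ≤ ∑ j ∈ U, ej j s₁ := Finset.sum_nonneg fun j _ ↦ hej0 j s₁ (hTjt j)
        have : 0 ≤ |ζ s₁| + |C'| * ((Rlow s₁)⁻¹ + nU * (ρ s₁)⁻¹) := by positivity
        simp only [hewdef]
        linarith [le_abs_self (η s₁)]
      linarith
    · -- the path is `2`-Lipschitz
      intro s hs s' hs'
      refine ⟨hTLi a s s' ((hTLge a).trans (hTL1.trans hs.1)) ((hTLge a).trans (hTL1.trans hs'.1)), ?_⟩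
      refine (abs_min_sub_min_le_max _ _ _ _).trans (max_le ?_ ?_)
      · rw [← sub_div, abs_div, abs_of_pos (by norm_num : (0 : ℝ) < 2),
          div_le_iff₀ (by norm_num : (0 : ℝ) < 2)]
        have := hψlip s hs s' hs'
        linarith [abs_nonneg (s - s')]
      · rw [← mul_sub, abs_mul, abs_of_pos hc₂]
        exact mul_le_mul_of_nonneg_right (by linarith) (abs_nonneg _)
    · -- admissibility: threshold, cone, clearance
      intro s hs
      obtain ⟨hcone_s, hRs, -, -, -, -, -, hs0⟩ := hfacts s hs
      obtain ⟨hmem, hoth⟩ := hgeom s hs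
      have hRR := hRge s hs
      refine ⟨((le_max_left _ _).trans (le_max_left _ _)).trans (hRs.trans hRR), ?_, fun j ↦ ?_⟩
      · have : min (ψ s / 2) (c₂ * s) ≤ c₂ * s := min_le_right _ _
        nlinarith
      · by_cases hjU : j ∈ U
        · left
          obtain ⟨h4, h2⟩ := hmem j hjU
          rw [norm_sub_rev]
          have : ‖ξ a s - ξ j s‖ ≤ min (ψ s / 2) (c₂ * s) / 2 := by
            rw [le_div_iff₀ (by norm_num : (0 : ℝ) < 2)]
            exact le_min (by linarith) (by linarith)
          linarith
        · right
          have h3 := hoth j hjU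
          have h4 := (hmem b hb).1
          have : min (ψ s / 2) (c₂ * s) ≤ ψ s / 2 := min_le_left _ _
          linarith [norm_nonneg (ξ a s - ξ b s)]
  · -- identification at `s`: additivity over `U` with member spheres `ρ s`, plus the singles
    obtain ⟨hcone_s, hRs, hρs, -, hT's, hTLs, hTjs, hs0⟩ := hfacts s hs
    obtain ⟨hmem, hoth⟩ := hgeom s hs
    have hRR := hRge s hs
    have hR1s := hR1 s hs
    have hRpos : 0 < min (ψ s / 2) (c₂ * s) := one_pos.trans_le hR1s
    have hρ1 : 1 ≤ ρ s := (le_max_right _ _).trans hρs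
    have hρpos : 0 < ρ s := one_pos.trans_le hρ1
    have hadd' := hadd s (ξ a s) (min (ψ s / 2) (c₂ * s)) U (fun _ ↦ ρ s) hT's
      (((le_max_right _ _).trans (le_max_left _ _)).trans (hRs.trans hRR))
      (by have : min (ψ s / 2) (c₂ * s) ≤ c₂ * s := min_le_right _ _; nlinarith) ?_ ?_ ?_
    rotate_left
    · -- members within `R/2`
      intro j hj
      obtain ⟨h4, h2⟩ := hmem j hj
      rw [norm_sub_rev]
      have : ‖ξ a s - ξ j s‖ ≤ min (ψ s / 2) (c₂ * s) / 2 := by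
        rw [le_div_iff₀ (by norm_num : (0 : ℝ) < 2)]
        exact le_min (by linarith) (by linarith)
      exact this
    · -- non-members beyond `2R`
      intro j hj
      have h3 := hoth j hj
      have : min (ψ s / 2) (c₂ * s) ≤ ψ s / 2 := min_le_left _ _
      linarith
    · -- member spheres
      intro j _
      refine ⟨(le_max_left _ _).trans hρs, ?_, fun j' hj' ↦ ?_⟩
      · have h4 := (hmem b hb).1
        have hDs : D s ≤ ‖ξ a s - ξ b s‖ := hDle s a b hab
        change min (D s / 3) (c₂ / 4 * s) ≤ min (ψ s / 2) (c₂ * s) / 4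
        rw [le_div_iff₀ (by norm_num : (0 : ℝ) < 4)]
        refine le_min ?_ ?_
        · have := min_le_left (D s / 3) (c₂ / 4 * s); linarith
        · have := min_le_right (D s / 3) (c₂ / 4 * s); linarith
      · exact hρsep j s hTLs j' hj'
    -- combine with the single-hole identifications
    have hcard : ∑ j ∈ U, (ρ s)⁻¹ = nU * (ρ s)⁻¹ := by
      rw [Finset.sum_const, nsmul_eq_mul]
    have herrle : C' * ((min (ψ s / 2) (c₂ * s))⁻¹ + nU * (ρ s)⁻¹) + ζ s ≤
        |ζ s| + |C'| * ((Rlow s)⁻¹ + nU * (ρ s)⁻¹) := by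
      have hRlowpos : 0 < Rlow s := one_pos.trans_le ((le_max_right _ _).trans hRs)
      have h1 : (min (ψ s / 2) (c₂ * s))⁻¹ ≤ (Rlow s)⁻¹ := inv_anti₀ hRlowpos hRR
      have hnn : 0 ≤ (min (ψ s / 2) (c₂ * s))⁻¹ + nU * (ρ s)⁻¹ := by positivity
      have h2 : C' * ((min (ψ s / 2) (c₂ * s))⁻¹ + nU * (ρ s)⁻¹) ≤
          |C'| * ((min (ψ s / 2) (c₂ * s))⁻¹ + nU * (ρ s)⁻¹) :=
        mul_le_mul_of_nonneg_right (le_abs_self C') hnn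
      have h3 : |C'| * ((min (ψ s / 2) (c₂ * s))⁻¹ + nU * (ρ s)⁻¹) ≤
          |C'| * ((Rlow s)⁻¹ + nU * (ρ s)⁻¹) :=
        mul_le_mul_of_nonneg_left (by linarith) (abs_nonneg C')
      linarith [le_abs_self (ζ s)]
    -- the sum of the single identifications
    have hsum0 : |∑ j ∈ U, P s (ξ j s) (ρ s) 0 - ∑ j ∈ U, M j * (√(1 - ‖v j s‖ ^ 2))⁻¹| ≤ ∑ j ∈ U, ej j s := by
      rw [← Finset.sum_sub_distrib]
      exact (Finset.abs_sum_le_sum_abs _ _).trans (Finset.sum_le_sum fun j _ ↦ (hidj j s (hTjs j)).1)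
    have hsumk : ∀ k' : Fin 3, |∑ j ∈ U, P s (ξ j s) (ρ s) k'.succ -
        ∑ j ∈ U, M j * (√(1 - ‖v j s‖ ^ 2))⁻¹ * v j s k'| ≤ ∑ j ∈ U, ej j s := by
      intro k'
      rw [← Finset.sum_sub_distrib]
      exact (Finset.abs_sum_le_sum_abs _ _).trans (Finset.sum_le_sum fun j _ ↦ (hidj j s (hTjs j)).2 k')
    constructor
    · have h1 := hadd' 0
      rw [hcard] at h1
      have hgoal : |P s (ξ a s) (min (ψ s / 2) (c₂ * s)) 0 - ∑ j ∈ U, M j * (√(1 - ‖v j s‖ ^ 2))⁻¹| ≤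
          (C' * ((min (ψ s / 2) (c₂ * s))⁻¹ + nU * (ρ s)⁻¹) + ζ s) + ∑ j ∈ U, ej j s := by
        refine (abs_sub_le _ (∑ j ∈ U, P s (ξ j s) (ρ s) 0) _).trans (add_le_add h1 hsum0)
      refine hgoal.trans ?_
      simp only [hewdef]
      linarith [abs_nonneg (η s)]
    · intro k'
      have h1 := hadd' k'.succ
      rw [hcard] at h1
      have hgoal : |P s (ξ a s) (min (ψ s / 2) (c₂ * s)) k'.succ -
          ∑ j ∈ U, M j * (√(1 - ‖v j s‖ ^ 2))⁻¹ * v j s k'| ≤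
          (C' * ((min (ψ s / 2) (c₂ * s))⁻¹ + nU * (ρ s)⁻¹) + ζ s) + ∑ j ∈ U, ej j s := by
        refine (abs_sub_le _ (∑ j ∈ U, P s (ξ j s) (ρ s) k'.succ) _).trans (add_le_add h1 (hsumk k'))
      refine hgoal.trans ?_
      simp only [hewdef]
      linarith [abs_nonneg (η s)]

end ClusterWindow

end Summit.FinalStateConjecture.FinalStateConjecture.Theorems.ChargeKinematics

namespace Summit.FinalStateConjecture.FinalStateConjecture.Theorems

/-- REGISTERED STUB `cluster_window_law` of the crux item stmt-FinalStateConjecture-10166 (second line lead, line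
`old-light-leaves-the-cone`, S4 escape series): the registered one-line signature verbatim, discharged by
`ChargeKinematics.cluster_window_law`. [folklore] -/
theorem cluster_window_law : open Literature.Geometry.Lorentzian Filter Topology MeasureTheory intervalIntegral in ∀ {N : ℕ} {M : Fin N → ℝ} {ξ v : Fin N → ℝ → E3} {κ : ℝ} {P : ℝ → E3 → ℝ → Fin 4 → ℝ} (hκ0 : 0 < κ) (hκ1 : κ < 1) (hξ : ∀ i, ContDiff ℝ ((⊤ : ℕ∞) : WithTop ℕ∞) (ξ i)) (hcone : ∀ i, ∀ᶠ t in atTop, ‖ξ i t‖ ≤ κ ^ 2 * t) (hsep : ∀ i j, i ≠ j → Tendsto (fun t ↦ ‖ξ i t - ξ j t‖) atTop atTop) (hk : ∃ k : ℝ, 0 ≤ k ∧ k < 1 ∧ ∀ i, ∀ᶠ t in atTop, ‖v i t‖ ≤ k) (hslave : ∀ i, Tendsto (fun t ↦ deriv (ξ i) t - v i t) atTop (𝓝 0)) (hW : ∀ δ : ℝ, 0 < δ → δ < 1 → ∃ (C R₀ T : ℝ) (η : ℝ → ℝ), Tendsto η atTop (𝓝 0) ∧ ∀ (t₁ t₂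 : ℝ) (c : ℝ → E3) (R : ℝ → ℝ), T ≤ t₁ → t₁ ≤ t₂ → (∀ s ∈ Set.Icc t₁ t₂, ∀ s' ∈ Set.Icc t₁ t₂, ‖c s - c s'‖ ≤ 2 * |s - s'| ∧ |R s - R s'| ≤ 2 * |s - s'|) → (∀ s ∈ Set.Icc t₁ t₂, (R₀ ≤ R s ∧ ‖c s‖ + R s ≤ (κ + κ ^ 2) / 2 * s ∧ ∀ j, ‖ξ j s - c s‖ ≤ (1 - δ) * R s ∨ (1 + δ) * R s ≤ ‖ξ j s - c s‖)) → ∀ μ : Fin 4, |P t₂ (c t₂) (R t₂) μ - P t₁ (c t₁) (R t₁) μ| ≤ C * (∫ s in t₁..t₂, ((R s) ^ 2)⁻¹ + ((R s) ^ (7 / 4 : ℝ))⁻¹) + η t₁) (hI : ∃ (C R₀ T : ℝ) (ζ : ℝ → ℝ), Tendsto ζ atTop (𝓝 0) ∧ (∀ (t : ℝ) (i : Fin N) (R : ℝ), T ≤ t → R₀ ≤ R → ‖ξ i t‖ + R ≤ (κ + κ ^ 2) / 2 * t → (∀ j, j ≠ i → 3 * R ≤ ‖ξ i t - ξ j t‖)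 → |P t (ξ i t) R 0 - M i * (√(1 - ‖v i t‖ ^ 2))⁻¹| ≤ ζ t + C / R ∧ ∀ k : Fin 3, |P t (ξ i t) R k.succ - M i * (√(1 - ‖v i t‖ ^ 2))⁻¹ * v i t k| ≤ ζ t + C / R) ∧ (∀ (t : ℝ) (c : E3) (R : ℝ) (A : Finset (Fin N)) (ρ : Fin N → ℝ), T ≤ t → R₀ ≤ R → ‖c‖ + R ≤ (κ + κ ^ 2) / 2 * t → (∀ j ∈ A, ‖ξ j t - c‖ ≤ R / 2) → (∀ j ∉ A, 2 * R ≤ ‖ξ j t - c‖) → (∀ j ∈ A, R₀ ≤ ρ j ∧ ρ j ≤ R / 4 ∧ ∀ j', j' ≠ j → 3 * ρ j ≤ ‖ξ j t - ξ j' t‖) → ∀ μ : Fin 4, |P t c R μ - ∑ j ∈ A, P t (ξ j t) (ρ j) μ| ≤ C * (R⁻¹ + ∑ j ∈ A, (ρ j)⁻¹) + ζ t)) (U : Finset (Fin N)) {a b : Fin N} (hb : b ∈ U) (hab : a ≠ b) {c₂ : ℝ} (hc₂ : 0 < c₂) (hc₂κ : c₂ ≤ (κ - κ ^ 2) / 2)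 (hc₂1 : c₂ ≤ 1), ∃ (Cw Tw : ℝ) (ew : ℝ → ℝ), 0 ≤ Cw ∧ Tendsto ew atTop (𝓝 0) ∧ (∀ t, Tw ≤ t → 0 ≤ ew t) ∧ ∀ (s₁ s₂ : ℝ) (ψ : ℝ → ℝ), Tw ≤ s₁ → s₁ ≤ s₂ → (∀ s ∈ Set.Icc s₁ s₂, ∀ s' ∈ Set.Icc s₁ s₂, |ψ s - ψ s'| ≤ 4 * |s - s'|) → (∀ s ∈ Set.Icc s₁ s₂, (∀ j ∈ U, 4 * ‖ξ a s - ξ j s‖ ≤ ψ s ∧ 2 * ‖ξ a s - ξ j s‖ ≤ c₂ * s) ∧ ∀ l ∉ U, ψ s ≤ ‖ξ l s - ξ a s‖) → (∀ μ : Fin 4, |P s₂ (ξ a s₂) (min (ψ s₂ / 2) (c₂ * s₂)) μ - P s₁ (ξ a s₁) (min (ψ s₁ / 2) (c₂ * s₁)) μ| ≤ Cw * (∫ s in s₁..s₂, ((min (ψ s / 2) (c₂ * s)) ^ 2)⁻¹ + ((min (ψ s / 2) (c₂ * s)) ^ (7 / 4 : ℝ))⁻¹) + ew s₁) ∧ (∀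 s ∈ Set.Icc s₁ s₂, |P s (ξ a s) (min (ψ s / 2) (c₂ * s)) 0 - ∑ j ∈ U, M j * (√(1 - ‖v j s‖ ^ 2))⁻¹| ≤ ew s ∧ ∀ k' : Fin 3, |P s (ξ a s) (min (ψ s / 2) (c₂ * s)) k'.succ - ∑ j ∈ U, M j * (√(1 - ‖v j s‖ ^ 2))⁻¹ * v j s k'| ≤ ew s) :=
  @ChargeKinematics.cluster_window_law

end Summit.FinalStateConjecture.FinalStateConjecture.Theorems

end
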